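import Summits.SmoothPoincare4.SmoothPoincare4.Theses.EntropyRung
import Literature.Geometry.Riemannian.RicciFlowMaximal
import Literature.Geometry.Riemannian.PerelmanEntropy
import HarnessLib.Audit

/-!
# Line `entropy-ratchet` — crux `EntropyRung.SubcylindricalRecognition` (stmt-SmoothPoincare4-10869)

Skeleton (crux-plan, round 1, idea card `Cruxes/SubcylindricalRecognition/Ideas/entropy-ratchet.md`,
triage TRIAGE-r1-{1,2,3}: pass ×3).  RUNG := "a Riemannian metric with `R > 0` and `ν(g) > ν_cyl`
on a closed smooth `M ≃ₕ S⁴` forces `M ≅ S⁴`".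

THE RATCHET.  Write `c₀ := 16π² Θ(S³×ℝ) = 32π²√π e^{-3/2}` (so `ν_cyl = log Θ(S³×ℝ)` and
`16π² e^{ν_cyl+δ} = c₀ e^δ`).  Four registered stubs and one route-item hypothesis:

* `stub_entropicSingularTime` (A, EntropicSingularTime): `R > 0` and `μ(g₀,τ) ≥ ν_cyl+δ ∀τ` on a
  closed connected `M⁴` ⇒ the maximal Ricci flow from `g₀` exists on `[0,T)` with `T < ∞`
  (`IsMaximalRicciFlow`, tree) and the entropy floor persists: `μ(g(t),τ) ≥ ν_cyl+δ` for all
  `t ∈ [0,T)`, `τ > 0` (Hamilton 1982 Thm 14.1 + `T ≤ 2/R_min` + Perelman's monotonicity of `μ`).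
* `stub_tangentFlowDensityFloor` (B, TangentFlowDensityFloor): such a flow has, at its (finite)
  singular time, a singularity model which is a COMPLETE SMOOTH non-flat normalised gradient
  shrinker `(N, g_N, f_N)` (`Ric + Hess f = g/2`, `R + |∇f|² = f`) of Gaussian density
  `∫ e^{-f_N} dV ≥ c₀ e^δ` (= `16π² e^{ν_cyl+δ}`), and if `N` is compact then `M ≅ N`
  (Bamler 2020: tangent flows at the first singular time are non-flat orbifold shrinkers with
  `log Θ ≥ ν(g₀)`; `Θ > Θ_cyl > 1/2` excludes orbifold points; a compact smooth tangent flow of a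
  flow on a connected closed `M` is diffeomorphic to `M`).
* route item `NoncompactShrinkerGap` (stmt-SmoothPoincare4-10868, hypothesis BY NAME): a
  non-compact model has `∫ e^{-f} dV ≤ c₀ < c₀ e^δ` — so the model is compact, `N ≅ M ≃ₕ S⁴`.
* `stub_higherEntropyOrRound` (C, HigherEntropyOrRound — the card's new lever, replacing the
  route's `CompactShrinkerGap`): a compact normalised shrinker `(N, g, f)` on a homotopy 4-sphere
  with `∫ e^{-f} dV > c₀` either lives on `N ≅ S⁴`, or `N` carries a metric `g'` with `R > 0` and a
  STRICTLY HIGHER entropy floor `δ'`: `c₀ e^{δ'} > ∫ e^{-f} dV` and `μ(g',τ) ≥ ν_cyl+δ' ∀τ`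
  (its provable core is the `b₂ = 0`, `Θ > Θ_cyl` corner of Hamilton's stability conjecture: the
  prover may assume `g` MAXIMISES `ν` among `R > 0` metrics on `N`, hence is `ν`-stable and linearly stable —
  Cao–Zhu 2012 Thm 1.1/1.3, Kröncke 2015 Thm 1.3/1.4, CHI 2004 §4; Einstein sub-case Hitchin/Gursky).
* `stub_finiteShrinkerDensities` (D, FiniteShrinkerDensities, CONDITIONAL on `NoncompactShrinkerGap`
  as the triage panel demanded): for a closed connected `M⁴` and every `c > c₀`, the set of
  densities `∫ e^{-f} dV ≥ c` of compact normalised shrinkers on manifolds diffeomorphic to `M` is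
  FINITE (Haslhofer–Müller 2011/2015 compactness + `Θ > 1/2` kills orbifold points + the gap kills
  non-compact limits + Kröncke 2015 Thm 4.4 Łojasiewicz ⇒ `Θ` locally constant on the moduli space).

`SubcylindricalRecognition_of : A → B → C → D → NoncompactShrinkerGap → RUNG` is PROVED below
(no sorry): strong induction on the number of shrinker densities of the diffeomorphism type of `M`
above the current floor `c₀ e^δ`; each turn of the ratchet (A, B, gap, C) either recognises `S⁴` or
raises the floor strictly above the density just met, which removes that density from the finite
set (D), so the count drops.  `M ≃ₕ S⁴` is USED (connectedness of `M`; hypothesis of C) — this is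
the `false_without_homotopyEquiv` obstruction of Disproof.lean (cdisprove cycle 1): honoured at C.

Namespace `…Cruxes.SubcylindricalRecognition.EntropyRatchet`; the four stub STATEMENTS are the
`def`s `EntropicSingularTime`, `TangentFlowDensityFloor`, `HigherEntropyOrRound`,
`FiniteShrinkerDensities` (fully unfolded over tree declarations, exactly the vocabulary of the route
file `Theses/EntropyRung.lean` rev 1 plus `IsMaximalRicciFlow` / `muEntropy` of
`RicciFlowMaximal.lean` / `PerelmanEntropy.lean`), each followed by its REGISTERED
`theorem stub_… : <same text> := by sorry`; the name-keyed aliases `Registered.stub_…` (abbrevs of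
the defs) are the hypotheses of `SubcylindricalRecognition_of`, so the native skeleton audit reads
them as the registered stubs (the `@[stub]` tag being gate-reserved).
-/

noncomputable section

open scoped Manifold ContDiff Topology ENNReal NNReal ContinuousMap
open Set MeasureTheory

namespace Summit.SmoothPoincare4.SmoothPoincare4.Cruxes.SubcylindricalRecognition.EntropyRatchet

open Summit.SmoothPoincare4.SmoothPoincare4.Theses.EntropyRung

/-! ## Stub A — the entropic singular time (Hamilton + `T ≤ 2/R_min` + Perelman monotonicity) -/

/-- **A. EntropicSingularTime.** On a closed connected smooth 4-manifold, a Riemannian metric `g₀`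
with `R > 0` and entropy floor `μ(g₀, τ) ≥ ν_cyl + δ` for all `τ > 0` (typed unfolded, verbatim the
hypothesis of the crux) is the initial metric of a MAXIMAL Ricci flow `(g, cov)` on `[0, T)`,
`0 < T < ∞` (`IsMaximalRicciFlow`, Topping 2006 p. 46 / Hamilton 1982 Thm 14.1; `T ≤ 2 / min R`
by `∂ₜR ≥ ΔR + ½R²`), along which the floor persists: `μ(g(t), τ) ≥ ν_cyl + δ` for every
`t ∈ [0, T)` and `τ > 0` (Perelman 2002 §3.1 (3.4): `μ(g(t), τ) ≥ μ(g(0), τ + t) ≥ ν(g₀)`;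
tree: `IsRicciFlow.muEntropy_le_muEntropy_interior`, `ricciFlow_maximal_existence`,
`ricciFlow_singularTime_le`, `le_muEntropy_iff`). Size L. -/
def EntropicSingularTime : Prop :=
  ∀ (M : Type) [TopologicalSpace M] [T2Space M] [SecondCountableTopology M]
    [ChartedSpace (EuclideanSpace ℝ (Fin 4)) M] [IsManifold (𝓡 4) ∞ M] [CompactSpace M]
    [ConnectedSpace M] [T3Space M] [MeasurableSpace M] [BorelSpace M]
    (g₀ : Literature.Geometry.Lorentzian.PseudoRiemannianMetric (𝓡 4) ∞ (EuclideanSpace ℝ (Fin 4))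
      (TangentSpace (𝓡 4) : M → Type _)) [g₀.HasLeviCivita] (hg₀ : g₀.IsRiemannian),
    (∀ x : M, 0 < g₀.scalarCurvature x) →
    ∀ δ : ℝ, 0 < δ →
    (∀ τ : ℝ, 0 < τ → ∀ f : M → ℝ, ContMDiff (𝓡 4) 𝓘(ℝ, ℝ) ∞ f →
      ∫ x, (4 * Real.pi * τ) ^ (-(4 : ℝ) / 2) * Real.exp (-f x)
        ∂(Literature.Geometry.Lorentzian.riemannianMeasure (g₀.toContMDiffRiemannianMetric hg₀)) = 1 →
      Real.log 2 + Real.log Real.pi / 2 - 3 / 2 + δ ≤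
        ∫ x, (τ * (g₀.scalarCurvature x + g₀.gradSq f x) + f x - 4) *
          ((4 * Real.pi * τ) ^ (-(4 : ℝ) / 2) * Real.exp (-f x))
          ∂(Literature.Geometry.Lorentzian.riemannianMeasure (g₀.toContMDiffRiemannianMetric hg₀))) →
    ∃ (T : ℝ)
      (g : ℝ → Literature.Geometry.Lorentzian.PseudoRiemannianMetric (𝓡 4) ∞
        (EuclideanSpace ℝ (Fin 4)) (TangentSpace (𝓡 4) : M → Type _))
      (cov : ℝ → CovariantDerivative (𝓡 4) (EuclideanSpace ℝ (Fin 4))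
        (TangentSpace (𝓡 4) : M → Type _)),
      Literature.Geometry.Riemannian.IsMaximalRicciFlow g cov T ∧ g 0 = g₀ ∧
      ∀ t ∈ Set.Ico (0 : ℝ) T, ∀ τ : ℝ, 0 < τ →
        ((Real.log 2 + Real.log Real.pi / 2 - 3 / 2 + δ : ℝ) : EReal) ≤ (g t).muEntropy (cov t) τ

/-- Registered stub A (statement = `EntropicSingularTime`, verbatim). -/
theorem stub_entropicSingularTime :
  ∀ (M : Type) [TopologicalSpace M] [T2Space M] [SecondCountableTopology M]
    [ChartedSpace (EuclideanSpace ℝ (Fin 4)) M] [IsManifold (𝓡 4) ∞ M] [CompactSpace M]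
    [ConnectedSpace M] [T3Space M] [MeasurableSpace M] [BorelSpace M]
    (g₀ : Literature.Geometry.Lorentzian.PseudoRiemannianMetric (𝓡 4) ∞ (EuclideanSpace ℝ (Fin 4))
      (TangentSpace (𝓡 4) : M → Type _)) [g₀.HasLeviCivita] (hg₀ : g₀.IsRiemannian),
    (∀ x : M, 0 < g₀.scalarCurvature x) →
    ∀ δ : ℝ, 0 < δ →
    (∀ τ : ℝ, 0 < τ → ∀ f : M → ℝ, ContMDiff (𝓡 4) 𝓘(ℝ, ℝ) ∞ f →
      ∫ x, (4 * Real.pi * τ) ^ (-(4 : ℝ) / 2) * Real.exp (-f x)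
        ∂(Literature.Geometry.Lorentzian.riemannianMeasure (g₀.toContMDiffRiemannianMetric hg₀)) = 1 →
      Real.log 2 + Real.log Real.pi / 2 - 3 / 2 + δ ≤
        ∫ x, (τ * (g₀.scalarCurvature x + g₀.gradSq f x) + f x - 4) *
          ((4 * Real.pi * τ) ^ (-(4 : ℝ) / 2) * Real.exp (-f x))
          ∂(Literature.Geometry.Lorentzian.riemannianMeasure (g₀.toContMDiffRiemannianMetric hg₀))) →
    ∃ (T : ℝ)
      (g : ℝ → Literature.Geometry.Lorentzian.PseudoRiemannianMetric (𝓡 4) ∞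
        (EuclideanSpace ℝ (Fin 4)) (TangentSpace (𝓡 4) : M → Type _))
      (cov : ℝ → CovariantDerivative (𝓡 4) (EuclideanSpace ℝ (Fin 4))
        (TangentSpace (𝓡 4) : M → Type _)),
      Literature.Geometry.Riemannian.IsMaximalRicciFlow g cov T ∧ g 0 = g₀ ∧
      ∀ t ∈ Set.Ico (0 : ℝ) T, ∀ τ : ℝ, 0 < τ →
        ((Real.log 2 + Real.log Real.pi / 2 - 3 / 2 + δ : ℝ) : EReal) ≤ (g t).muEntropy (cov t) τ := by
  sorry

/-! ## Stub B — the density floor of the first singularity model (Perelman 𝒩 + Bamler 2020) -/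

/-- **B. TangentFlowDensityFloor.** Let `(g, cov)` be a maximal Ricci flow on `[0, T)`, `T < ∞`,
on a closed connected smooth 4-manifold `M`, with `μ(g(t), τ) ≥ ν_cyl + δ` (`δ > 0`) for all
`t ∈ [0,T)`, `τ > 0`. Then some singularity model at time `T` — a tangent flow at a point of
Bamler's singular set, Bamler 2020 (arXiv:2009.03243) §2.6/§2.10 — is a COMPLETE SMOOTH connected
gradient shrinking soliton `(N, g_N, f_N)`, normalised `Ric + Hess f = g/2`, `R + |∇f|² = f`,
non-flat, whose Gaussian density satisfies `∫_N e^{-f_N} dV ≥ 32π²√π e^{-3/2} · e^δ`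
(= `16π² e^{ν_cyl + δ}`: `log Θ(N) = lim 𝒩 ≥ μ(g(t−τ), τ) ≥ ν_cyl + δ`, Perelman/Bamler, with the
Carrillo–Ni normalisation `16π² Θ = ∫ e^{-f}`); orbifold points are excluded because a cone point
`ℝ⁴/Γ` forces `Θ ≤ 1/|Γ| ≤ 1/2 < e^{ν_cyl}`; and if `N` is compact then (smooth convergence of
the rescaled flow onto a compact model, `M` connected) `M` is diffeomorphic to `N`. Typed: the
conclusion lists `N` with the binder shape of `NoncompactShrinkerGap` / `CompactShrinkerGap` so
that either route density gap applies verbatim. Size XL (Bamler's 𝔽-limit theory is not in the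
tree). -/
def TangentFlowDensityFloor : Prop :=
  ∀ (M : Type) [TopologicalSpace M] [T2Space M] [SecondCountableTopology M]
    [ChartedSpace (EuclideanSpace ℝ (Fin 4)) M] [IsManifold (𝓡 4) ∞ M] [CompactSpace M]
    [ConnectedSpace M] [T3Space M] [MeasurableSpace M] [BorelSpace M]
    (T : ℝ)
    (g : ℝ → Literature.Geometry.Lorentzian.PseudoRiemannianMetric (𝓡 4) ∞
      (EuclideanSpace ℝ (Fin 4)) (TangentSpace (𝓡 4) : M → Type _))
    (cov : ℝ → CovariantDerivative (𝓡 4) (EuclideanSpace ℝ (Fin 4))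
      (TangentSpace (𝓡 4) : M → Type _)),
    Literature.Geometry.Riemannian.IsMaximalRicciFlow g cov T →
    ∀ δ : ℝ, 0 < δ →
    (∀ t ∈ Set.Ico (0 : ℝ) T, ∀ τ : ℝ, 0 < τ →
      ((Real.log 2 + Real.log Real.pi / 2 - 3 / 2 + δ : ℝ) : EReal) ≤ (g t).muEntropy (cov t) τ) →
    ∃ (N : Type) (_ : TopologicalSpace N) (_ : T2Space N) (_ : SecondCountableTopology N)
      (_ : ChartedSpace (EuclideanSpace ℝ (Fin 4)) N) (_ : IsManifold (𝓡 4) ∞ N)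
      (_ : ConnectedSpace N) (_ : T3Space N) (_ : MeasurableSpace N) (_ : BorelSpace N)
      (gN : Literature.Geometry.Lorentzian.PseudoRiemannianMetric (𝓡 4) ∞ (EuclideanSpace ℝ (Fin 4))
        (TangentSpace (𝓡 4) : N → Type _)) (_ : gN.HasLeviCivita) (fN : N → ℝ)
      (hgN : gN.IsRiemannian),
      (∀ (x : N) (r : NNReal), IsCompact {y : N | gN.edist hgN x y ≤ r}) ∧
      ContMDiff (𝓡 4) 𝓘(ℝ, ℝ) ∞ fN ∧
      (∀ (x : N) (X Y : TangentSpace (𝓡 4) x),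
        gN.ricci x X Y + gN.hessian fN x X Y = (1 / 2 : ℝ) * gN.val x X Y) ∧
      (∀ x : N, gN.scalarCurvature x + gN.gradSq fN x = fN x) ∧
      (∃ x : N, gN.scalarCurvature x ≠ 0) ∧
      ENNReal.ofReal (32 * Real.pi ^ 2 * Real.sqrt Real.pi * Real.exp (-(3 : ℝ) / 2) * Real.exp δ) ≤
        ∫⁻ x, ENNReal.ofReal (Real.exp (-fN x))
          ∂(Literature.Geometry.Lorentzian.riemannianMeasure (gN.toContMDiffRiemannianMetric hgN)) ∧
      (CompactSpace N → Nonempty (M ≃ₘ⟮𝓡 4, 𝓡 4⟯ N))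

/-- Registered stub B (statement = `TangentFlowDensityFloor`, verbatim). -/
theorem stub_tangentFlowDensityFloor :
  ∀ (M : Type) [TopologicalSpace M] [T2Space M] [SecondCountableTopology M]
    [ChartedSpace (EuclideanSpace ℝ (Fin 4)) M] [IsManifold (𝓡 4) ∞ M] [CompactSpace M]
    [ConnectedSpace M] [T3Space M] [MeasurableSpace M] [BorelSpace M]
    (T : ℝ)
    (g : ℝ → Literature.Geometry.Lorentzian.PseudoRiemannianMetric (𝓡 4) ∞
      (EuclideanSpace ℝ (Fin 4)) (TangentSpace (𝓡 4) : M → Type _))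
    (cov : ℝ → CovariantDerivative (𝓡 4) (EuclideanSpace ℝ (Fin 4))
      (TangentSpace (𝓡 4) : M → Type _)),
    Literature.Geometry.Riemannian.IsMaximalRicciFlow g cov T →
    ∀ δ : ℝ, 0 < δ →
    (∀ t ∈ Set.Ico (0 : ℝ) T, ∀ τ : ℝ, 0 < τ →
      ((Real.log 2 + Real.log Real.pi / 2 - 3 / 2 + δ : ℝ) : EReal) ≤ (g t).muEntropy (cov t) τ) →
    ∃ (N : Type) (_ : TopologicalSpace N) (_ : T2Space N) (_ : SecondCountableTopology N)
      (_ : ChartedSpace (EuclideanSpace ℝ (Fin 4)) N) (_ : IsManifold (𝓡 4) ∞ N)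
      (_ : ConnectedSpace N) (_ : T3Space N) (_ : MeasurableSpace N) (_ : BorelSpace N)
      (gN : Literature.Geometry.Lorentzian.PseudoRiemannianMetric (𝓡 4) ∞ (EuclideanSpace ℝ (Fin 4))
        (TangentSpace (𝓡 4) : N → Type _)) (_ : gN.HasLeviCivita) (fN : N → ℝ)
      (hgN : gN.IsRiemannian),
      (∀ (x : N) (r : NNReal), IsCompact {y : N | gN.edist hgN x y ≤ r}) ∧
      ContMDiff (𝓡 4) 𝓘(ℝ, ℝ) ∞ fN ∧
      (∀ (x : N) (X Y : TangentSpace (𝓡 4) x),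
        gN.ricci x X Y + gN.hessian fN x X Y = (1 / 2 : ℝ) * gN.val x X Y) ∧
      (∀ x : N, gN.scalarCurvature x + gN.gradSq fN x = fN x) ∧
      (∃ x : N, gN.scalarCurvature x ≠ 0) ∧
      ENNReal.ofReal (32 * Real.pi ^ 2 * Real.sqrt Real.pi * Real.exp (-(3 : ℝ) / 2) * Real.exp δ) ≤
        ∫⁻ x, ENNReal.ofReal (Real.exp (-fN x))
          ∂(Literature.Geometry.Lorentzian.riemannianMeasure (gN.toContMDiffRiemannianMetric hgN)) ∧
      (CompactSpace N → Nonempty (M ≃ₘ⟮𝓡 4, 𝓡 4⟯ N)) := by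
  sorry

/-! ## Stub C — higher entropy or round (the `b₂ = 0`, `Θ > Θ_cyl` corner of Hamilton's conjecture) -/

/-- **C. HigherEntropyOrRound** (the card's lever; WEAKER than route item `CompactShrinkerGap`,
which gives the left disjunct outright). A compact normalised gradient shrinker `(N, g, f)`
(`Ric + Hess f = g/2`, `R + |∇f|² = f`, `f` smooth) on a closed smooth `N ≃ₕ S⁴` with Gaussian
density `∫ e^{-f} dV > 32π²√π e^{-3/2}` (`Θ > Θ(S³×ℝ)`) EITHER lives on `N ≅ S⁴`, OR is NOT a
maximiser of Perelman's `ν` among `R > 0` metrics on `N` in the following effective sense: there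
are a Riemannian `g'` on `N` with `R_{g'} > 0` and `δ' > 0` with `32π²√π e^{-3/2} e^{δ'} > ∫ e^{-f} dV`
(i.e. `ν_cyl + δ' > log Θ(N,g,f) = ν(g)`, Carrillo–Ni 2009 Cor 4.1 / Li–Wang 2019 (2.5)) and
`μ(g', τ) ≥ ν_cyl + δ'` for all `τ > 0` (typed unfolded, verbatim the hypothesis of the crux, so
the ratchet can restart from `g'`). Provable core: if no such `g'` exists then `g` maximises `ν`
on the open set `{R > 0} ∋ g`, so `ν''_g ≤ 0` (Cao–Zhu arXiv:1008.0842 Thm 1.1) and the spectral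
constraint of Cao–Zhu Thm 1.3 holds; Hamilton's conjecture (ibid. p. 2; Kröncke arXiv:1403.3721
Thm 1.3/1.4) predicts such a stable compact 4-d shrinker is `S⁴` or `ℂP²`, and `b₂(N) = 0`,
`Θ > .791 > .609 = Θ(ℂP²)` leave the round `S⁴` (Kuiper, tree: `kuiper_conformallyFlat_sphere_four_holds`);
Einstein sub-case: Hitchin 1974 / Gursky 2000 (`Θ ≤ .271` unless round). Why it might fail only
via ¬SPC4 (an exotic `N` carrying a `ν`-maximal dense shrinker); its CORE may simply be out of
reach (compact non-Einstein 4-d shrinkers with `b₂ = 0` are unclassified). Size L / open. -/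
def HigherEntropyOrRound : Prop :=
  ∀ (N : Type) [TopologicalSpace N] [T2Space N] [SecondCountableTopology N]
    [ChartedSpace (EuclideanSpace ℝ (Fin 4)) N] [IsManifold (𝓡 4) ∞ N] [CompactSpace N] [T3Space N]
    [MeasurableSpace N] [BorelSpace N],
    N ≃ₕ Metric.sphere (0 : EuclideanSpace ℝ (Fin 5)) 1 →
    ∀ (g : Literature.Geometry.Lorentzian.PseudoRiemannianMetric (𝓡 4) ∞ (EuclideanSpace ℝ (Fin 4))
      (TangentSpace (𝓡 4) : N → Type _)) [g.HasLeviCivita] (f : N → ℝ) (hg : g.IsRiemannian),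
    ContMDiff (𝓡 4) 𝓘(ℝ, ℝ) ∞ f →
    (∀ (x : N) (X Y : TangentSpace (𝓡 4) x),
      g.ricci x X Y + g.hessian f x X Y = (1 / 2 : ℝ) * g.val x X Y) →
    (∀ x : N, g.scalarCurvature x + g.gradSq f x = f x) →
    ENNReal.ofReal (32 * Real.pi ^ 2 * Real.sqrt Real.pi * Real.exp (-(3 : ℝ) / 2)) <
      ∫⁻ x, ENNReal.ofReal (Real.exp (-f x))
        ∂(Literature.Geometry.Lorentzian.riemannianMeasure (g.toContMDiffRiemannianMetric hg)) →
    Nonempty (N ≃ₘ⟮𝓡 4, 𝓡 4⟯ (Metric.sphere (0 : EuclideanSpace ℝ (Fin 5)) 1)) ∨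
    ∃ g' : Literature.Geometry.Lorentzian.PseudoRiemannianMetric (𝓡 4) ∞ (EuclideanSpace ℝ (Fin 4))
        (TangentSpace (𝓡 4) : N → Type _), ∃ _ : g'.HasLeviCivita, ∃ hg' : g'.IsRiemannian,
      (∀ x : N, 0 < g'.scalarCurvature x) ∧
      ∃ δ' : ℝ, 0 < δ' ∧
        ∫⁻ x, ENNReal.ofReal (Real.exp (-f x))
            ∂(Literature.Geometry.Lorentzian.riemannianMeasure (g.toContMDiffRiemannianMetric hg)) <
          ENNReal.ofReal (32 * Real.pi ^ 2 * Real.sqrt Real.pi * Real.exp (-(3 : ℝ) / 2) * Real.exp δ') ∧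
        ∀ τ : ℝ, 0 < τ → ∀ φ : N → ℝ, ContMDiff (𝓡 4) 𝓘(ℝ, ℝ) ∞ φ →
          ∫ x, (4 * Real.pi * τ) ^ (-(4 : ℝ) / 2) * Real.exp (-φ x)
            ∂(Literature.Geometry.Lorentzian.riemannianMeasure (g'.toContMDiffRiemannianMetric hg')) = 1 →
          Real.log 2 + Real.log Real.pi / 2 - 3 / 2 + δ' ≤
            ∫ x, (τ * (g'.scalarCurvature x + g'.gradSq φ x) + φ x - 4) *
              ((4 * Real.pi * τ) ^ (-(4 : ℝ) / 2) * Real.exp (-φ x))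
              ∂(Literature.Geometry.Lorentzian.riemannianMeasure (g'.toContMDiffRiemannianMetric hg'))

/-- Registered stub C (statement = `HigherEntropyOrRound`, verbatim). -/
theorem stub_higherEntropyOrRound :
  ∀ (N : Type) [TopologicalSpace N] [T2Space N] [SecondCountableTopology N]
    [ChartedSpace (EuclideanSpace ℝ (Fin 4)) N] [IsManifold (𝓡 4) ∞ N] [CompactSpace N] [T3Space N]
    [MeasurableSpace N] [BorelSpace N],
    N ≃ₕ Metric.sphere (0 : EuclideanSpace ℝ (Fin 5)) 1 →
    ∀ (g : Literature.Geometry.Lorentzian.PseudoRiemannianMetric (𝓡 4) ∞ (EuclideanSpace ℝ (Fin 4))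
      (TangentSpace (𝓡 4) : N → Type _)) [g.HasLeviCivita] (f : N → ℝ) (hg : g.IsRiemannian),
    ContMDiff (𝓡 4) 𝓘(ℝ, ℝ) ∞ f →
    (∀ (x : N) (X Y : TangentSpace (𝓡 4) x),
      g.ricci x X Y + g.hessian f x X Y = (1 / 2 : ℝ) * g.val x X Y) →
    (∀ x : N, g.scalarCurvature x + g.gradSq f x = f x) →
    ENNReal.ofReal (32 * Real.pi ^ 2 * Real.sqrt Real.pi * Real.exp (-(3 : ℝ) / 2)) <
      ∫⁻ x, ENNReal.ofReal (Real.exp (-f x))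
        ∂(Literature.Geometry.Lorentzian.riemannianMeasure (g.toContMDiffRiemannianMetric hg)) →
    Nonempty (N ≃ₘ⟮𝓡 4, 𝓡 4⟯ (Metric.sphere (0 : EuclideanSpace ℝ (Fin 5)) 1)) ∨
    ∃ g' : Literature.Geometry.Lorentzian.PseudoRiemannianMetric (𝓡 4) ∞ (EuclideanSpace ℝ (Fin 4))
        (TangentSpace (𝓡 4) : N → Type _), ∃ _ : g'.HasLeviCivita, ∃ hg' : g'.IsRiemannian,
      (∀ x : N, 0 < g'.scalarCurvature x) ∧
      ∃ δ' : ℝ, 0 < δ' ∧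
        ∫⁻ x, ENNReal.ofReal (Real.exp (-f x))
            ∂(Literature.Geometry.Lorentzian.riemannianMeasure (g.toContMDiffRiemannianMetric hg)) <
          ENNReal.ofReal (32 * Real.pi ^ 2 * Real.sqrt Real.pi * Real.exp (-(3 : ℝ) / 2) * Real.exp δ') ∧
        ∀ τ : ℝ, 0 < τ → ∀ φ : N → ℝ, ContMDiff (𝓡 4) 𝓘(ℝ, ℝ) ∞ φ →
          ∫ x, (4 * Real.pi * τ) ^ (-(4 : ℝ) / 2) * Real.exp (-φ x)
            ∂(Literature.Geometry.Lorentzian.riemannianMeasure (g'.toContMDiffRiemannianMetric hg')) = 1 →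
          Real.log 2 + Real.log Real.pi / 2 - 3 / 2 + δ' ≤
            ∫ x, (τ * (g'.scalarCurvature x + g'.gradSq φ x) + φ x - 4) *
              ((4 * Real.pi * τ) ^ (-(4 : ℝ) / 2) * Real.exp (-φ x))
              ∂(Literature.Geometry.Lorentzian.riemannianMeasure (g'.toContMDiffRiemannianMetric hg')) := by
  sorry

/-! ## Stub D — finiteness of the density spectrum above the cylinder (HM compactness + Łojasiewicz) -/

/-- **D. FiniteShrinkerDensities** (conditional on the route's `NoncompactShrinkerGap`, as the
triage panel required: Haslhofer–Müller limits could otherwise be NON-compact). GIVEN the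
non-compact density gap, for every closed connected smooth 4-manifold `M` and every
`c > 32π²√π e^{-3/2}` (`= 16π² Θ(S³×ℝ)`), the DENSITY SPECTRUM of the diffeomorphism type of `M`
above `c` — the set of values `∫_N e^{-f} dV ≥ c` over compact normalised gradient shrinkers
`(N, g, f)` (`Ric + Hess f = g/2`, `R + |∇f|² = f`, `f` smooth) with `N ≅ M` — is FINITE.
Proof sketch: a sequence with pairwise distinct densities `≥ c` has entropy `μ ≥ log(c/16π²)`,
so Haslhofer–Müller (arXiv:1005.3255 Thm 1.1/1.2; arXiv:1407.1683 Thm 1.1: in dimension 4 the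
entropy bound alone suffices, `χ` fixed) gives an orbifold Cheeger–Gromov sub-limit, a shrinker
with `Θ = lim Θᵢ ≥ c/16π²` (uniform Gaussian tails: Cao–Zhou 2010 / HM Lemma 2.1–2.2); `Θ > 1/2`
forbids cone points, Yokota's gap forbids the flat limit, the GAP forbids a non-compact limit
(`Θ ≤ Θ_cyl < c/16π²`), so the limit is a compact shrinker on `M` and the convergence is smooth up
to diffeomorphisms; Kröncke's Łojasiewicz inequality for `ν` (arXiv:1403.3721 Thm 4.4) makes `ν`,
hence `Θ = e^ν` (Carrillo–Ni), constant on shrinkers `C^{2,α}`-near the limit — contradicting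
distinctness. Size L. -/
def FiniteShrinkerDensities : Prop :=
  NoncompactShrinkerGap →
  ∀ (M : Type) [TopologicalSpace M] [T2Space M] [SecondCountableTopology M]
    [ChartedSpace (EuclideanSpace ℝ (Fin 4)) M] [IsManifold (𝓡 4) ∞ M] [CompactSpace M]
    [ConnectedSpace M],
    ∀ c : ℝ, 32 * Real.pi ^ 2 * Real.sqrt Real.pi * Real.exp (-(3 : ℝ) / 2) < c →
    Set.Finite {v : ℝ≥0∞ | ENNReal.ofReal c ≤ v ∧
      ∃ (N : Type) (_ : TopologicalSpace N) (_ : T2Space N) (_ : SecondCountableTopology N)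
        (_ : ChartedSpace (EuclideanSpace ℝ (Fin 4)) N) (_ : IsManifold (𝓡 4) ∞ N)
        (_ : CompactSpace N) (_ : T3Space N) (_ : MeasurableSpace N) (_ : BorelSpace N)
        (gN : Literature.Geometry.Lorentzian.PseudoRiemannianMetric (𝓡 4) ∞ (EuclideanSpace ℝ (Fin 4))
          (TangentSpace (𝓡 4) : N → Type _)) (_ : gN.HasLeviCivita) (fN : N → ℝ)
        (hgN : gN.IsRiemannian),
        Nonempty (M ≃ₘ⟮𝓡 4, 𝓡 4⟯ N) ∧ ContMDiff (𝓡 4) 𝓘(ℝ, ℝ) ∞ fN ∧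
        (∀ (x : N) (X Y : TangentSpace (𝓡 4) x),
          gN.ricci x X Y + gN.hessian fN x X Y = (1 / 2 : ℝ) * gN.val x X Y) ∧
        (∀ x : N, gN.scalarCurvature x + gN.gradSq fN x = fN x) ∧
        v = ∫⁻ x, ENNReal.ofReal (Real.exp (-fN x))
          ∂(Literature.Geometry.Lorentzian.riemannianMeasure (gN.toContMDiffRiemannianMetric hgN))}

/-- Registered stub D (statement = `FiniteShrinkerDensities`, verbatim). -/
theorem stub_finiteShrinkerDensities :
  NoncompactShrinkerGap →
  ∀ (M : Type) [TopologicalSpace M] [T2Space M] [SecondCountableTopology M]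
    [ChartedSpace (EuclideanSpace ℝ (Fin 4)) M] [IsManifold (𝓡 4) ∞ M] [CompactSpace M]
    [ConnectedSpace M],
    ∀ c : ℝ, 32 * Real.pi ^ 2 * Real.sqrt Real.pi * Real.exp (-(3 : ℝ) / 2) < c →
    Set.Finite {v : ℝ≥0∞ | ENNReal.ofReal c ≤ v ∧
      ∃ (N : Type) (_ : TopologicalSpace N) (_ : T2Space N) (_ : SecondCountableTopology N)
        (_ : ChartedSpace (EuclideanSpace ℝ (Fin 4)) N) (_ : IsManifold (𝓡 4) ∞ N)
        (_ : CompactSpace N) (_ : T3Space N) (_ : MeasurableSpace N) (_ : BorelSpace N)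
        (gN : Literature.Geometry.Lorentzian.PseudoRiemannianMetric (𝓡 4) ∞ (EuclideanSpace ℝ (Fin 4))
          (TangentSpace (𝓡 4) : N → Type _)) (_ : gN.HasLeviCivita) (fN : N → ℝ)
        (hgN : gN.IsRiemannian),
        Nonempty (M ≃ₘ⟮𝓡 4, 𝓡 4⟯ N) ∧ ContMDiff (𝓡 4) 𝓘(ℝ, ℝ) ∞ fN ∧
        (∀ (x : N) (X Y : TangentSpace (𝓡 4) x),
          gN.ricci x X Y + gN.hessian fN x X Y = (1 / 2 : ℝ) * gN.val x X Y) ∧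
        (∀ x : N, gN.scalarCurvature x + gN.gradSq fN x = fN x) ∧
        v = ∫⁻ x, ENNReal.ofReal (Real.exp (-fN x))
          ∂(Literature.Geometry.Lorentzian.riemannianMeasure (gN.toContMDiffRiemannianMetric hgN))} := by
  sorry

/-! ## Consistency: each `@[stub]` statement IS its registered stub (definitional) -/

theorem entropicSingularTime_holds : EntropicSingularTime := stub_entropicSingularTime
theorem tangentFlowDensityFloor_holds : TangentFlowDensityFloor := stub_tangentFlowDensityFloor
theorem higherEntropyOrRound_holds : HigherEntropyOrRound := stub_higherEntropyOrRound
theorem finiteShrinkerDensities_holds : FiniteShrinkerDensities := stub_finiteShrinkerDensities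

/-! ## Name-keyed aliases of the four statements (hypotheses of the composition)

`Registered.stub_X` is `X`'s statement under the registered stub's short name, so that the skeleton
audit (`#h21_check_skeleton`, hypotheses admissible iff route items or registered stubs BY NAME)
accepts `SubcylindricalRecognition_of : Registered.stub_A → … → NoncompactShrinkerGap → RUNG`. -/
namespace Registered

/-- Alias of `EntropicSingularTime` keyed by the registered stub name. -/
abbrev stub_entropicSingularTime : Prop := EntropicSingularTime
/-- Alias of `TangentFlowDensityFloor` keyed by the registered stub name. -/
abbrev stub_tangentFlowDensityFloor : Prop := TangentFlowDensityFloor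
/-- Alias of `HigherEntropyOrRound` keyed by the registered stub name. -/
abbrev stub_higherEntropyOrRound : Prop := HigherEntropyOrRound
/-- Alias of `FiniteShrinkerDensities` keyed by the registered stub name. -/
abbrev stub_finiteShrinkerDensities : Prop := FiniteShrinkerDensities

end Registered

/-- The registered stubs inhabit the aliases (so the lead's final `SubcylindricalRecognition_proof` is
`SubcylindricalRecognition_of stub_entropicSingularTime stub_tangentFlowDensityFloor
stub_higherEntropyOrRound stub_finiteShrinkerDensities NoncompactShrinkerGap_holds`). -/
example : Registered.stub_entropicSingularTime ∧ Registered.stub_tangentFlowDensityFloor ∧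
    Registered.stub_higherEntropyOrRound ∧ Registered.stub_finiteShrinkerDensities :=
  ⟨stub_entropicSingularTime, stub_tangentFlowDensityFloor, stub_higherEntropyOrRound,
    stub_finiteShrinkerDensities⟩

/-! ## The ratchet: bookkeeping objects of the composition (local, not stubs) -/

/-- `c₀ = 16π² Θ(S³×ℝ) = 32π²√π e^{-3/2}` (the route's typed cylinder threshold for `∫ e^{-f} dV`). -/
def cylThreshold : ℝ := 32 * Real.pi ^ 2 * Real.sqrt Real.pi * Real.exp (-(3 : ℝ) / 2)

theorem cylThreshold_pos : 0 < cylThreshold := by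
  unfold cylThreshold; positivity

theorem cylThreshold_lt_mul_exp {δ : ℝ} (hδ : 0 < δ) : cylThreshold < cylThreshold * Real.exp δ := by
  have h1 : (1 : ℝ) < Real.exp δ := by
    have := Real.add_one_le_exp δ
    linarith
  exact lt_mul_of_one_lt_right cylThreshold_pos h1

/-- The **density spectrum** of the diffeomorphism type of `M` above `c` (the set of stub D). -/
def densitySpectrum (M : Type) [TopologicalSpace M] [ChartedSpace (EuclideanSpace ℝ (Fin 4)) M]
    (c : ℝ) : Set ℝ≥0∞ :=
  {v : ℝ≥0∞ | ENNReal.ofReal c ≤ v ∧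
      ∃ (N : Type) (_ : TopologicalSpace N) (_ : T2Space N) (_ : SecondCountableTopology N)
        (_ : ChartedSpace (EuclideanSpace ℝ (Fin 4)) N) (_ : IsManifold (𝓡 4) ∞ N)
        (_ : CompactSpace N) (_ : T3Space N) (_ : MeasurableSpace N) (_ : BorelSpace N)
        (gN : Literature.Geometry.Lorentzian.PseudoRiemannianMetric (𝓡 4) ∞ (EuclideanSpace ℝ (Fin 4))
          (TangentSpace (𝓡 4) : N → Type _)) (_ : gN.HasLeviCivita) (fN : N → ℝ)
        (hgN : gN.IsRiemannian),
        Nonempty (M ≃ₘ⟮𝓡 4, 𝓡 4⟯ N) ∧ ContMDiff (𝓡 4) 𝓘(ℝ, ℝ) ∞ fN ∧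
        (∀ (x : N) (X Y : TangentSpace (𝓡 4) x),
          gN.ricci x X Y + gN.hessian fN x X Y = (1 / 2 : ℝ) * gN.val x X Y) ∧
        (∀ x : N, gN.scalarCurvature x + gN.gradSq fN x = fN x) ∧
        v = ∫⁻ x, ENNReal.ofReal (Real.exp (-fN x))
          ∂(Literature.Geometry.Lorentzian.riemannianMeasure (gN.toContMDiffRiemannianMetric hgN))}

/-- Stub D unfolds to finiteness of `densitySpectrum`. -/
theorem densitySpectrum_finite (hD : FiniteShrinkerDensities) (hGap : NoncompactShrinkerGap)
    (M : Type) [TopologicalSpace M] [T2Space M] [SecondCountableTopology M]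
    [ChartedSpace (EuclideanSpace ℝ (Fin 4)) M] [IsManifold (𝓡 4) ∞ M] [CompactSpace M]
    [ConnectedSpace M] {c : ℝ} (hc : cylThreshold < c) : (densitySpectrum M c).Finite :=
  hD hGap M c hc

/-- **Diffeomorphism invariance / monotonicity of the spectrum**: if `M ≅ N` and
`ofReal c ≤ ofReal c'` then the spectrum of `N` above `c'` lies in the spectrum of `M` above `c`. -/
theorem densitySpectrum_subset {M N : Type} [TopologicalSpace M]
    [ChartedSpace (EuclideanSpace ℝ (Fin 4)) M] [TopologicalSpace N]
    [ChartedSpace (EuclideanSpace ℝ (Fin 4)) N] (φ : M ≃ₘ⟮𝓡 4, 𝓡 4⟯ N) {c c' : ℝ}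
    (hcc' : ENNReal.ofReal c ≤ ENNReal.ofReal c') :
    densitySpectrum N c' ⊆ densitySpectrum M c := by
  rintro v ⟨hv, N', i1, i2, i3, i4, i5, i6, i7, i8, i9, gN, iLC, fN, hgN, ⟨ψ⟩, hf, hsol, hnorm, hv'⟩
  exact ⟨hcc'.trans hv, N', i1, i2, i3, i4, i5, i6, i7, i8, i9, gN, iLC, fN, hgN, ⟨φ.trans ψ⟩, hf,
    hsol, hnorm, hv'⟩

/-! ## The composition: A → B → C → D → NoncompactShrinkerGap → RUNG (kernel-checked, no sorry) -/

/-- **The entropy ratchet proves the crux from the four stubs and the route's non-compact gap.**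
Strong induction on `n = #(densitySpectrum M (c₀ e^δ))`: given `(M ≃ₕ S⁴, g, R > 0, floor δ)`,
A gives the maximal flow with the floor, B a complete smooth non-flat normalised model `N` with
`∫ e^{-f_N} ≥ c₀ e^δ`; if `N` were non-compact the gap would give `∫ e^{-f_N} ≤ c₀ < c₀ e^δ`, so
`N` is compact and `M ≅ N ≃ₕ S⁴`; C on `N`: either `N ≅ S⁴` (done, `M ≅ N ≅ S⁴`) or a metric `g'`
on `N` with `R > 0` and floor `δ'`, `c₀ e^{δ'} > ∫ e^{-f_N} ≥ c₀ e^δ`; then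
`densitySpectrum N (c₀ e^{δ'}) ⊊ densitySpectrum M (c₀ e^δ)` (it omits `∫ e^{-f_N}`; D makes the
larger set finite), and the induction hypothesis applied to `(N, g', δ')` returns `N ≅ S⁴`. -/
theorem SubcylindricalRecognition_of (hA : Registered.stub_entropicSingularTime)
    (hB : Registered.stub_tangentFlowDensityFloor) (hC : Registered.stub_higherEntropyOrRound)
    (hD : Registered.stub_finiteShrinkerDensities) (hGap : NoncompactShrinkerGap) :
    SubcylindricalRecognition := by
  -- reduce to the counted statement
  suffices key : ∀ (n : ℕ) (M : Type) [TopologicalSpace M] [T2Space M] [SecondCountableTopology M]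
      [ChartedSpace (EuclideanSpace ℝ (Fin 4)) M] [IsManifold (𝓡 4) ∞ M] [CompactSpace M] [T3Space M]
      [MeasurableSpace M] [BorelSpace M],
      M ≃ₕ Metric.sphere (0 : EuclideanSpace ℝ (Fin 5)) 1 →
      ∀ (g : Literature.Geometry.Lorentzian.PseudoRiemannianMetric (𝓡 4) ∞ (EuclideanSpace ℝ (Fin 4))
        (TangentSpace (𝓡 4) : M → Type _)) [g.HasLeviCivita] (hg : g.IsRiemannian),
      (∀ x : M, 0 < g.scalarCurvature x) →
      ∀ δ : ℝ, 0 < δ →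
      (∀ τ : ℝ, 0 < τ → ∀ f : M → ℝ, ContMDiff (𝓡 4) 𝓘(ℝ, ℝ) ∞ f →
        ∫ x, (4 * Real.pi * τ) ^ (-(4 : ℝ) / 2) * Real.exp (-f x)
          ∂(Literature.Geometry.Lorentzian.riemannianMeasure (g.toContMDiffRiemannianMetric hg)) = 1 →
        Real.log 2 + Real.log Real.pi / 2 - 3 / 2 + δ ≤
          ∫ x, (τ * (g.scalarCurvature x + g.gradSq f x) + f x - 4) *
            ((4 * Real.pi * τ) ^ (-(4 : ℝ) / 2) * Real.exp (-f x))
            ∂(Literature.Geometry.Lorentzian.riemannianMeasure (g.toContMDiffRiemannianMetric hg))) →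
      (densitySpectrum M (cylThreshold * Real.exp δ)).ncard = n →
      Nonempty (M ≃ₘ⟮𝓡 4, 𝓡 4⟯ (Metric.sphere (0 : EuclideanSpace ℝ (Fin 5)) 1)) by
    intro M _ _ _ _ _ _ _ _ _ e g _ hg hR hν
    obtain ⟨δ, hδ, hfl⟩ := hν
    exact key _ M e g hg hR δ hδ hfl rfl
  intro n
  induction n using Nat.strong_induction_on with
  | _ n ih =>
  intro M _ _ _ _ _ _ _ _ _ e g _ hg hR δ hδ hfl hn
  -- `M ≃ₕ S⁴` is connected (and nonempty)
  haveI := Literature.Topology.FourManifolds.pathConnectedSpace_sphere_four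
  haveI : PathConnectedSpace M := Literature.Topology.FourManifolds.pathConnectedSpace_of_homotopyEquiv e
  -- A: the maximal flow with the entropy floor
  obtain ⟨T, gfl, cov, hmax, -, hfloor⟩ := hA M g hg hR δ hδ hfl
  -- B: the first singularity model with its density floor
  obtain ⟨N, _, _, _, _, _, _, _, _, _, gN, _, fN, hgN, hcompl, hfN, hsol, hnorm, hnonflat, hdens,
    hcpt⟩ := hB M T gfl cov hmax δ hδ hfloor
  -- the model is compact: otherwise the non-compact gap contradicts the floor
  by_cases hc : CompactSpace N
  swap
  · exfalso
    haveI : NoncompactSpace N := not_compactSpace_iff.mp hc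
    have hle := hGap N gN fN hgN hcompl hfN hsol hnorm hnonflat
    have h := (ENNReal.ofReal_le_ofReal_iff cylThreshold_pos.le).mp (hdens.trans hle)
    exact absurd h (not_le.mpr (cylThreshold_lt_mul_exp hδ))
  haveI := hc
  obtain ⟨φ⟩ := hcpt hc
  -- `N ≅ M ≃ₕ S⁴`
  have eN : N ≃ₕ Metric.sphere (0 : EuclideanSpace ℝ (Fin 5)) 1 :=
    (φ.symm.toHomeomorph.toHomotopyEquiv).trans e
  -- C on the model
  have hlt0 : ENNReal.ofReal cylThreshold <
      ∫⁻ x, ENNReal.ofReal (Real.exp (-fN x))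
        ∂(Literature.Geometry.Lorentzian.riemannianMeasure (gN.toContMDiffRiemannianMetric hgN)) :=
    lt_of_lt_of_le ((ENNReal.ofReal_lt_ofReal_iff (cylThreshold_pos.trans
      (cylThreshold_lt_mul_exp hδ))).mpr (cylThreshold_lt_mul_exp hδ)) hdens
  rcases hC N eN gN fN hgN hfN hsol hnorm hlt0 with hψ | ⟨g', _, hg', hR', δ', hδ', hlt, hfl'⟩
  · exact hψ.map φ.trans
  -- the ratchet: the spectrum of `N` above the new floor is strictly smaller
  have hfinM : (densitySpectrum M (cylThreshold * Real.exp δ)).Finite :=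
    densitySpectrum_finite hD hGap M (cylThreshold_lt_mul_exp hδ)
  have hsub : densitySpectrum N (cylThreshold * Real.exp δ') ⊆
      densitySpectrum M (cylThreshold * Real.exp δ) :=
    densitySpectrum_subset φ (hdens.trans hlt.le)
  have hmem : (∫⁻ x, ENNReal.ofReal (Real.exp (-fN x))
      ∂(Literature.Geometry.Lorentzian.riemannianMeasure (gN.toContMDiffRiemannianMetric hgN))) ∈
      densitySpectrum M (cylThreshold * Real.exp δ) :=
    ⟨hdens, N, inferInstance, inferInstance, inferInstance, inferInstance, inferInstance, hc,
      inferInstance, inferInstance, inferInstance, gN, inferInstance, fN, hgN, ⟨φ⟩, hfN, hsol, hnorm,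
      rfl⟩
  have hnmem : (∫⁻ x, ENNReal.ofReal (Real.exp (-fN x))
      ∂(Literature.Geometry.Lorentzian.riemannianMeasure (gN.toContMDiffRiemannianMetric hgN))) ∉
      densitySpectrum N (cylThreshold * Real.exp δ') :=
    fun h ↦ (not_le.mpr hlt) h.1
  have hssub : densitySpectrum N (cylThreshold * Real.exp δ') ⊂
      densitySpectrum M (cylThreshold * Real.exp δ) :=
    ssubset_of_subset_not_subset hsub (fun h ↦ hnmem (h hmem))
  have hcard : (densitySpectrum N (cylThreshold * Real.exp δ')).ncard < n := by
    rw [← hn]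
    exact Set.ncard_lt_ncard hssub hfinM
  -- restart from `(N, g', δ')`
  obtain ⟨χ⟩ := ih _ hcard N eN g' hg' hR' δ' hδ' hfl' rfl
  exact ⟨φ.trans χ⟩

end Summit.SmoothPoincare4.SmoothPoincare4.Cruxes.SubcylindricalRecognition.EntropyRatchet

end
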